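import Mathlib
import HarnessLib
import Summits.QuantumAdvantage.QuantumAdvantage.Theorems.RigidityLawsA
import Summits.QuantumAdvantage.AdviceFreeQNC0.WalkTransport
import Summits.QuantumAdvantage.AdviceFreeQNC0.CrossTeamEmbedding
import Summits.QuantumAdvantage.AdviceFreeQNC0.WalkHardFJunta
import Literature.Computability.MetaComplexity.SmolenskyCorrelationRestrict

set_option linter.dupNamespace false
set_option autoImplicit false

/-!
# FibreDial (A) — window fibres of the u-walk game: 1 : 1 floor, dead zone, window transport (cell decomp-qadv, lens 4, g18)

Prop-definition-free tree twin of the lens-4 g18 node `FibreDial` (supports of item stmt-QuantumAdvantage-28489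
`AbsorptionDial.MassHiQuarter`; negative knowledge for its method family).  u-WALK family `ringWinU` on `k + m` bits split
as prefix `a : {0,1}^k` ++ window `w : {0,1}^m` (`Fin.append`); arbitrary prime `p` through `HasDegF`.
* §1 `two_pow_le_losers_of_fibreLoss` — a loss on every window fibre gives `2^k` losses (no degree hypothesis, no absorption).
* §2 DEAD ZONE `fibrePerfect_of_le` — for `m ≤ d` the window-greedy strategy `greedy` (cut `k` fires iff `c+k+2|a|+|w|` is
  live, cut `k+1` iff it is dead; a window junta) is PERFECT on `0^k ++ {0,1}^m`: subcube-exactness certifies `< 2^(n−d)` losses.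
* §2⁺ WINDOW TRANSPORT `plant` / `hasDegF_plant` / `ringWinU_plant` / `fibrePerfect_of_perfect` / `exists_loss_of_fibreLoss` —
  an `m`-bit strategy planted on the window cuts keeps degree and win bit (`e_{k+j}(a ++ w) = 2|a| + e_j(w)`).
0 sorry; axioms standard; no `instance`, no `notation`, no `native_decide`; no `def … : Prop`.
-/

open Finset
open Literature.Computability.MetaComplexity Literature.Computability.MetaComplexity.Smolensky
open Summit.QuantumAdvantage.AdviceFreeQNC0

namespace Summit.QuantumAdvantage.QuantumAdvantage.Theorems.FibreDial

variable {p : ℕ} [Fact p.Prime]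

/-! ## §1 The 1 : 1 floor -/
/-- **(K1) FIBRE LOSSES GIVE A `2^k` FLOOR — exchange rate 1 : 1, no absorption, no degree hypothesis.**  If a
strategy on `k + m` bits loses somewhere on every prefix-frozen window fibre `a ++ {0,1}^m`, it has at least `2^k` losses
(one per fibre; the fibres are disjoint).  Contrast `AbsorptionDialC.two_pow_le_losers_of_noPerfect` (rate `d ↦ d+2kd+1`). -/
theorem two_pow_le_losers_of_fibreLoss {k m : ℕ} (c : ℕ) (y : Fin (k + m + 1) → (Fin (k + m) → Bool) → Bool)
    (h : ∀ a : Fin k → Bool, ∃ w : Fin m → Bool, ringWinU c y (Fin.append a w) = false) :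
    2 ^ k ≤ (univ.filter fun u : Fin (k + m) → Bool => ringWinU c y u = false).card := by
  classical
  choose w hw using h
  have hinj : Function.Injective fun a : Fin k → Bool => Fin.append a (w a) := by
    intro a a' haa
    funext i
    have := congrFun haa (Fin.castAdd m i)
    simpa only [Fin.append_left] using this
  calc 2 ^ k = (univ : Finset (Fin k → Bool)).card := by simp
    _ = ((univ : Finset (Fin k → Bool)).image fun a => Fin.append a (w a)).card :=
        (card_image_of_injective _ hinj).symm
    _ ≤ _ := by
        refine card_le_card fun u hu => ?_
        obtain ⟨a, -, rfl⟩ := mem_image.mp hu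
        simpa using hw a

/-! ## §2 (K2) The dead zone: window-greedy play is perfect on fibres of dimension `≤ d` -/
section Greedy
variable {k m : ℕ}

/-- weight of the window (the last `m` coordinates). -/
def wtWin (k m : ℕ) (u : Fin (k + m) → Bool) : ℕ := (univ.filter fun j : Fin m => u (Fin.natAdd k j) = true).card

/-- on the fibre over `a` the window weight is `|w|`. -/
theorem wtWin_append (a : Fin k → Bool) (w : Fin m → Bool) : wtWin k m (Fin.append a w) = wt w := by
  unfold wtWin wt
  congr 1
  ext j
  simp [Fin.append_right]

/-- **the window-greedy strategy** for the fibres over prefixes of weight `α` at charge `c`: cut `k` (the first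
window cut) fires iff its label `c + k + 2α + |w|` is live, cut `k + 1` fires iff that label is dead; all other
cuts are silent.  Its cuts read only the window. -/
def greedy (k m c α : ℕ) : Fin (k + m + 1) → (Fin (k + m) → Bool) → Bool := fun g u =>
  if g.val = k then decide ((c + k + 2 * α + wtWin k m u) % 3 ≠ 0)
  else if g.val = k + 1 then decide ((c + k + 2 * α + wtWin k m u) % 3 = 0)
  else false

/-- firing table of the window-greedy strategy. -/
theorem greedy_eq_true_iff (c α : ℕ) (g : Fin (k + m + 1)) (u : Fin (k + m) → Bool) :
    greedy k m c α g u = true ↔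
      (g.val = k ∧ (c + k + 2 * α + wtWin k m u) % 3 ≠ 0) ∨
        (g.val = k + 1 ∧ (c + k + 2 * α + wtWin k m u) % 3 = 0) := by
  unfold greedy
  by_cases h0 : g.val = k
  · simp [h0]
  · by_cases h1 : g.val = k + 1
    · simp [h1]
    · simp [h0, h1]

/-- window weight is a junta on the window. -/
theorem wtWin_congr {u v : Fin (k + m) → Bool} (h : ∀ j : Fin m, u (Fin.natAdd k j) = v (Fin.natAdd k j)) :
    wtWin k m u = wtWin k m v := by
  unfold wtWin
  congr 1
  exact filter_congr fun j _ => by rw [h j]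

/-- the window coordinates. -/
def window (k m : ℕ) : Finset (Fin (k + m)) := univ.image (Fin.natAdd k)

/-- the window has `m` coordinates. -/
theorem card_window : (window k m).card = m := by
  unfold window
  rw [card_image_of_injective _ (fun i j hij => by simpa using hij)]
  simp

/-- every cut of the window-greedy strategy has `𝔽_p`-degree `≤ m` (a junta on the `m` window bits). -/
theorem hasDegF_greedy (c α : ℕ) (g : Fin (k + m + 1)) : HasDegF p (greedy k m c α g) m := by
  have h := hasDegF_of_junta (p := p) (window k m) (greedy k m c α g) (fun u v huv => by
    have hW : wtWin k m u = wtWin k m v :=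
      wtWin_congr fun j => huv (Fin.natAdd k j) (by unfold window; exact mem_image_of_mem _ (mem_univ j))
    have e : ∀ b : Bool, (greedy k m c α g u = b) ↔ (greedy k m c α g v = b) := by
      intro b
      cases b
      · rw [Bool.eq_false_iff, Bool.eq_false_iff, ne_eq, ne_eq, greedy_eq_true_iff, greedy_eq_true_iff, hW]
      · rw [greedy_eq_true_iff, greedy_eq_true_iff, hW]
    exact (e _).mpr rfl)
  rwa [card_window] at h

/-- … hence degree `≤ d` whenever `m ≤ d`. -/
theorem hasDegF_greedy_of_le {d : ℕ} (hmd : m ≤ d) (c α : ℕ) (g : Fin (k + m + 1)) :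
    HasDegF p (greedy k m c α g) d :=
  lowDeg_mono hmd (hasDegF_greedy c α g)

/-- prefix weights one step on. -/
theorem wtPrefix_succ' {n : ℕ} (u : Fin n → Bool) {g : ℕ} (hg : g < n) :
    wtPrefix u (g + 1) = wtPrefix u g + (if u ⟨g, hg⟩ = true then 1 else 0) := by
  unfold wtPrefix
  have hsplit : (univ.filter fun i : Fin n => i.val < g + 1 ∧ u i = true) =
      (univ.filter fun i : Fin n => i.val < g ∧ u i = true) ∪
        (univ.filter fun i : Fin n => i = ⟨g, hg⟩ ∧ u i = true) := by
    ext i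
    simp only [mem_filter, mem_univ, true_and, mem_union, Fin.ext_iff]
    constructor
    · rintro ⟨hi, hu⟩
      rcases Nat.lt_succ_iff_lt_or_eq.mp hi with hi | hi
      · exact Or.inl ⟨hi, hu⟩
      · exact Or.inr ⟨hi, hu⟩
    · rintro (⟨hi, hu⟩ | ⟨hi, hu⟩)
      · exact ⟨by omega, hu⟩
      · exact ⟨by omega, hu⟩
  rw [hsplit, card_union_of_disjoint (disjoint_filter.mpr fun i _ h1 h2 => by
    rw [Fin.ext_iff] at h2; simp at h2; omega)]
  congr 1
  by_cases hu : u ⟨g, hg⟩ = true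
  · rw [if_pos hu, card_eq_one]
    refine ⟨⟨g, hg⟩, ?_⟩
    ext i
    simp only [mem_filter, mem_univ, true_and, mem_singleton]
    constructor
    · exact fun h => h.1
    · intro h; rw [h]; exact ⟨rfl, hu⟩
  · rw [if_neg hu, card_eq_zero, filter_eq_empty_iff]
    rintro i - ⟨hi, hui⟩
    rw [hi] at hui; exact hu hui

/-- a full prefix weighs the whole word. -/
theorem wtPrefix_full (a : Fin k → Bool) : wtPrefix a k = wt a := by
  unfold wtPrefix wt; congr 1; ext i; simp

/-- the walk exponent at the first window cut on the fibre: `|a| + |w| + |a|`. -/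
theorem walkExp_append_k (a : Fin k → Bool) (w : Fin m → Bool) :
    walkExp (Fin.append a w) k = wt a + wt w + wt a := by
  unfold walkExp
  rw [wt_append, wtPrefix_append_of_le a w le_rfl,
    wtPrefix_full a]

/-- … and at the second window cut: one more `[w₀]`. -/
theorem walkExp_append_k_succ (hm : 0 < m) (a : Fin k → Bool) (w : Fin m → Bool) :
    walkExp (Fin.append a w) (k + 1) = wt a + wt w + wt a + (if w ⟨0, hm⟩ = true then 1 else 0) := by
  have hk : k < k + m := by omega
  unfold walkExp
  rw [wtPrefix_succ' _ hk, wt_append, wtPrefix_append_of_le a w le_rfl,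
    wtPrefix_full a]
  have e : Fin.append a w ⟨k, hk⟩ = w ⟨0, hm⟩ := by
    have : (⟨k, hk⟩ : Fin (k + m)) = Fin.natAdd k ⟨0, hm⟩ := Fin.ext (by simp)
    rw [this, Fin.append_right]
  rw [e]
  ring

/-- **WINDOW-GREEDY IS PERFECT ON ITS FIBRES** (`m ≥ 1`): on every fibre `a ++ {0,1}^m` with `|a| = α` the strategy
`greedy k m c α` wins at every point — if the first window cut is live it is the only cut fired; otherwise the
second window cut is fired alone and its label is `1 + [w₀] ∈ {1, 2}`. -/
theorem greedy_perfect (hm : 0 < m) (c : ℕ) (a : Fin k → Bool) (w : Fin m → Bool) :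
    ringWinU c (greedy k m c (wt a)) (Fin.append a w) = true := by
  classical
  unfold ringWinU
  rw [decide_eq_true_eq]
  have hW : wtWin k m (Fin.append a w) = wt w := wtWin_append a w
  have hEk := walkExp_append_k a w
  have hEk1 := walkExp_append_k_succ hm a w
  have hk1 : k + 1 < k + m + 1 := by omega
  by_cases hA : (c + k + 2 * wt a + wt w) % 3 ≠ 0
  · have hS : (univ.filter fun g : Fin (k + m + 1) =>
        greedy k m c (wt a) g (Fin.append a w) = true ∧ (c + g.val + walkExp (Fin.append a w) g.val) % 3 ≠ 0) =
        {⟨k, by omega⟩} := by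
      ext g
      simp only [mem_filter, mem_univ, true_and, mem_singleton, greedy_eq_true_iff, hW]
      constructor
      · rintro ⟨(⟨hg, -⟩ | ⟨-, hB⟩), -⟩
        · exact Fin.ext hg
        · exact absurd hB hA
      · intro hg
        rw [hg]
        refine ⟨Or.inl ⟨rfl, hA⟩, ?_⟩
        show (c + k + walkExp (Fin.append a w) k) % 3 ≠ 0
        rw [hEk]; intro h; apply hA; omega
    rw [hS, card_singleton]
  · have hS : (univ.filter fun g : Fin (k + m + 1) =>
        greedy k m c (wt a) g (Fin.append a w) = true ∧ (c + g.val + walkExp (Fin.append a w) g.val) % 3 ≠ 0) =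
        {⟨k + 1, hk1⟩} := by
      ext g
      simp only [mem_filter, mem_univ, true_and, mem_singleton, greedy_eq_true_iff, hW]
      constructor
      · rintro ⟨(⟨-, hB⟩ | ⟨hg, -⟩), -⟩
        · exact absurd hB hA
        · exact Fin.ext hg
      · intro hg
        rw [hg]
        refine ⟨Or.inr ⟨rfl, not_not.mp hA⟩, ?_⟩
        show (c + (k + 1) + walkExp (Fin.append a w) (k + 1)) % 3 ≠ 0
        rw [hEk1]
        have h0 := not_not.mp hA
        by_cases hw : w ⟨0, hm⟩ = true
        · rw [if_pos hw]; intro h; omega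
        · rw [if_neg hw]; intro h; omega
    rw [hS, card_singleton]

/-- at window dimension `m = 0`: the strategy firing cut `0` constantly wins at `0^k` for charge `1`. -/
theorem fibrePerfect_zero (d k : ℕ) :
    ∃ c : ℕ, ∃ y : Fin (k + 0 + 1) → (Fin (k + 0) → Bool) → Bool, (∀ g, HasDegF p (y g) d) ∧
      ∃ a : Fin k → Bool, ∀ w : Fin 0 → Bool, ringWinU c y (Fin.append a w) = true := by
  refine ⟨1, fun g _ => decide (g.val = 0), fun g => ?_, fun _ => false, fun w => ?_⟩
  · show HasDegF p (fun _ : Fin (k + 0) → Bool => decide (g.val = 0)) d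
    by_cases hg : g.val = 0
    · have e : (fun _ : Fin (k + 0) → Bool => decide (g.val = 0)) = fun _ => true := by funext u; simp [hg]
      rw [e]; exact RigidityLaws.hasDegF_const p true d
    · have e : (fun _ : Fin (k + 0) → Bool => decide (g.val = 0)) = fun _ => false := by funext u; simp [hg]
      rw [e]; exact RigidityLaws.hasDegF_const p false d
  · have hwt : wt (Fin.append (fun _ : Fin k => false) w) = 0 := by
      rw [wt_append]
      have h1 : wt (fun _ : Fin k => false) = 0 := by simp [wt]
      have h2 : wt w = 0 := by unfold wt; rw [card_eq_zero, filter_eq_empty_iff]; intro j; exact j.elim0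
      rw [h1, h2]
    unfold ringWinU
    rw [decide_eq_true_eq]
    have hS : (univ.filter fun g : Fin (k + 0 + 1) =>
        decide (g.val = 0) = true ∧ (1 + g.val + walkExp (Fin.append (fun _ : Fin k => false) w) g.val) % 3 ≠ 0) =
        {⟨0, by omega⟩} := by
      ext g
      simp only [mem_filter, mem_univ, true_and, mem_singleton, decide_eq_true_eq]
      constructor
      · rintro ⟨hg, -⟩; exact Fin.ext hg
      · intro hg
        rw [hg]
        refine ⟨rfl, ?_⟩
        show (1 + 0 + walkExp (Fin.append (fun _ : Fin k => false) w) 0) % 3 ≠ 0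
        unfold walkExp
        have h0 : wtPrefix (Fin.append (fun _ : Fin k => false) w) 0 = 0 := by simp [wtPrefix]
        rw [hwt, h0]
        decide
    rw [hS, card_singleton]

/-- **(K2) THE DEAD ZONE `m ≤ d`.**  On every window fibre of dimension `m ≤ d` some strategy of cut degree `≤ d` is
PERFECT (window-greedy on `0^k ++ {0,1}^m`).  Hence NO «the strategy loses on every window fibre of dimension m»
hypothesis with `m ≤ d` is ever available: exactness-on-subcubes arguments certify fewer than `2^(n−d)` losses. -/
theorem fibrePerfect_of_le {d k m : ℕ} (hmd : m ≤ d) :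
    ∃ c : ℕ, ∃ y : Fin (k + m + 1) → (Fin (k + m) → Bool) → Bool, (∀ g, HasDegF p (y g) d) ∧
      ∃ a : Fin k → Bool, ∀ w : Fin m → Bool, ringWinU c y (Fin.append a w) = true := by
  rcases Nat.eq_zero_or_pos m with rfl | hm
  · exact fibrePerfect_zero d k
  · exact ⟨0, greedy k m 0 (wt fun _ : Fin k => false), fun g => hasDegF_greedy_of_le hmd 0 _ g,
      fun _ => false, fun w => greedy_perfect hm 0 (fun _ : Fin k => false) w⟩

end Greedy

/-! ## §2⁺ (K2⁺) Window transport: fibre exactness is at least plain exactness on the window -/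
section Transport
variable {k m : ℕ}

/-- read the window (the last `m` coordinates). -/
def windowOf (k m : ℕ) (u : Fin (k + m) → Bool) : Fin m → Bool := fun j => u (Fin.natAdd k j)

/-- reading the window of `a ++ w` returns `w`. -/
theorem windowOf_append (a : Fin k → Bool) (w : Fin m → Bool) : windowOf k m (Fin.append a w) = w := by
  funext j
  simp [windowOf, Fin.append_right]

/-- **plant** an `m`-bit strategy on the window cuts `k, …, k + m` of `k + m` bits (all earlier cuts silent). -/
def plant (k : ℕ) (y' : Fin (m + 1) → (Fin m → Bool) → Bool) :
    Fin (k + m + 1) → (Fin (k + m) → Bool) → Bool := fun g u =>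
  if h : k ≤ g.val then y' ⟨g.val - k, by omega⟩ (windowOf k m u) else false

/-- planting keeps the cut degree (substitution of variables, `Smolensky.comp_subst_mem_lowDeg`). -/
theorem hasDegF_plant {d : ℕ} (y' : Fin (m + 1) → (Fin m → Bool) → Bool) (hy' : ∀ j, HasDegF p (y' j) d)
    (g : Fin (k + m + 1)) : HasDegF p (plant k y' g) d := by
  unfold plant
  by_cases h : k ≤ g.val
  · simp only [h, dite_true]
    exact comp_subst_mem_lowDeg (F := ZMod p) (windowOf k m)
      (fun i => Or.inr ⟨Fin.natAdd k i, fun x => rfl⟩) (hy' ⟨g.val - k, by omega⟩)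
  · simp only [h, dite_false]
    exact RigidityLaws.hasDegF_const p false d

/-- the shift `j ↦ k + j` of cut indices. -/
def shiftEmb (k m : ℕ) : Fin (m + 1) ↪ Fin (k + m + 1) :=
  ⟨fun j => ⟨k + j.val, by omega⟩, fun i j h => Fin.ext (by
    have : k + i.val = k + j.val := congrArg Fin.val h
    omega)⟩

/-- value of the shift. -/
theorem shiftEmb_val (j : Fin (m + 1)) : (shiftEmb k m j).val = k + j.val := rfl

/-- the planted strategy at cut `k + j` is cut `j` of `y'` read on the window. -/
theorem plant_apply_shift (y' : Fin (m + 1) → (Fin m → Bool) → Bool) (j : Fin (m + 1)) (u : Fin (k + m) → Bool) :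
    plant k y' (shiftEmb k m j) u = y' j (windowOf k m u) := by
  have e : (⟨k + j.val - k, by omega⟩ : Fin (m + 1)) = j := Fin.ext (by simp)
  show (if h : k ≤ k + j.val then y' ⟨k + j.val - k, by omega⟩ (windowOf k m u) else false) = _
  rw [dif_pos (Nat.le_add_right _ _), e]

/-- walk exponents on the window cuts of a fibre: `2|a| + e_j(w)`. -/
theorem walkExp_append_window (a : Fin k → Bool) (w : Fin m → Bool) (j : ℕ) :
    walkExp (Fin.append a w) (k + j) = 2 * wt a + walkExp w j := by
  unfold walkExp
  rw [wt_append, wtPrefix_append_of_ge a w (Nat.le_add_right k j), Nat.add_sub_cancel_left]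
  ring

/-- the fired-and-live cuts of the planted strategy on the fibre over `a` at charge `c` are the shifted
fired-and-live cuts of `y'` at any charge `c' ≡ c + k + 2|a|`. -/
theorem filter_plant (c c' : ℕ) (y' : Fin (m + 1) → (Fin m → Bool) → Bool) (a : Fin k → Bool)
    (w : Fin m → Bool) (hc : (c + k + 2 * wt a) % 3 = c' % 3) :
    (univ.filter fun g : Fin (k + m + 1) =>
        plant k y' g (Fin.append a w) = true ∧ (c + g.val + walkExp (Fin.append a w) g.val) % 3 ≠ 0) =
      (univ.filter fun j : Fin (m + 1) => y' j w = true ∧ (c' + j.val + walkExp w j.val) % 3 ≠ 0).map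
        (shiftEmb k m) := by
  ext g
  simp only [mem_filter, mem_univ, true_and, mem_map]
  constructor
  · rintro ⟨hfire, hlive⟩
    have hkg : k ≤ g.val := by
      by_contra hlt
      unfold plant at hfire
      rw [dif_neg hlt] at hfire
      exact Bool.noConfusion hfire
    have e : g = shiftEmb k m ⟨g.val - k, by omega⟩ := Fin.ext (by show g.val = k + (g.val - k); omega)
    refine ⟨⟨g.val - k, by omega⟩, ⟨?_, ?_⟩, e.symm⟩
    · rw [e, plant_apply_shift, windowOf_append] at hfire
      exact hfire
    · have hE := walkExp_append_window a w (g.val - k)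
      rw [show k + (g.val - k) = g.val by omega] at hE
      rw [hE] at hlive
      show (c' + (g.val - k) + walkExp w (g.val - k)) % 3 ≠ 0
      intro h0
      apply hlive
      omega
  · rintro ⟨j, ⟨hfire, hlive⟩, rfl⟩
    refine ⟨by rw [plant_apply_shift, windowOf_append]; exact hfire, ?_⟩
    rw [shiftEmb_val, walkExp_append_window]
    intro h0
    apply hlive
    omega

/-- **WINDOW TRANSPORT OF THE WIN BIT.** -/
theorem ringWinU_plant (c c' : ℕ) (y' : Fin (m + 1) → (Fin m → Bool) → Bool) (a : Fin k → Bool)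
    (w : Fin m → Bool) (hc : (c + k + 2 * wt a) % 3 = c' % 3) :
    ringWinU c (plant k y') (Fin.append a w) = ringWinU c' y' w := by
  unfold ringWinU
  rw [filter_plant c c' y' a w hc, card_map]

/-- **(K2⁺) WINDOW TRANSPORT: a perfect `m`-bit strategy of cut degree `≤ d` yields, for every co-dimension `k`, a
degree-`≤ d` strategy on `k + m` bits that is PERFECT ON THE WINDOW FIBRE `0^k ++ {0,1}^m` (charge shifted by `2k`).**
So «loses on every window fibre of dimension m, cut degree ≤ d» is at least «no perfect m-bit strategy of degree ≤ d»
— relative degree `d` against `m`, not against `k + m`. -/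
theorem fibrePerfect_of_perfect {d k m : ℕ} (c' : ℕ) (y' : Fin (m + 1) → (Fin m → Bool) → Bool)
    (hy' : ∀ j, HasDegF p (y' j) d) (hperf : ∀ w, ringWinU c' y' w = true) :
    (∀ g, HasDegF p (plant k y' g) d) ∧
      ∀ w : Fin m → Bool, ringWinU (c' + 2 * k) (plant k y') (Fin.append (fun _ : Fin k => false) w) = true := by
  refine ⟨hasDegF_plant y' hy', fun w => ?_⟩
  have h0 : wt (fun _ : Fin k => false) = 0 := by simp [wt]
  rw [ringWinU_plant (c' + 2 * k) c' y' (fun _ => false) w (by rw [h0]; omega), hperf w]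

/-- contrapositive form: fibre losses on ALL window fibres of dimension `m` (for all degree-`≤ d` strategies on
`k + m` bits, all charges) imply plain exactness on `m` bits at degree `d`, every charge. -/
theorem exists_loss_of_fibreLoss {d k m : ℕ}
    (h : ∀ c : ℕ, ∀ y : Fin (k + m + 1) → (Fin (k + m) → Bool) → Bool, (∀ g, HasDegF p (y g) d) →
      ∀ a : Fin k → Bool, ∃ w : Fin m → Bool, ringWinU c y (Fin.append a w) = false)
    (c' : ℕ) (y' : Fin (m + 1) → (Fin m → Bool) → Bool) (hy' : ∀ j, HasDegF p (y' j) d) :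
    ∃ w, ringWinU c' y' w = false := by
  by_contra hne
  push Not at hne
  obtain ⟨hdeg, hwin⟩ := fibrePerfect_of_perfect (k := k) c' y' hy' (fun w => by simpa using hne w)
  obtain ⟨w, hw⟩ := h (c' + 2 * k) (plant k y') hdeg (fun _ => false)
  rw [hwin w] at hw
  exact Bool.noConfusion hw

end Transport

end Summit.QuantumAdvantage.QuantumAdvantage.Theorems.FibreDial
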